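import Literature.AlgebraicGeometry.Motives.GaloisThickeningFrobeniusSheet        -- ★ GAL family + `isoMk_thickeningGalAction_aut_hom` (B-p18)
import Literature.AlgebraicGeometry.Motives.GaloisThickeningQuotient              -- ★ `exists_algEquiv_comp_eq_of_normal` (A-p18)
import Literature.AlgebraicGeometry.Motives.IntegralModelReductionMapSurjective   -- ★ `IntegralModel.geomReductionMap_surjective` (RS)
import HarnessLib

/-!
# The special fibre of a proper flat model of the Galois thickening is COVERED by the deck-translates of the reductions of ONE sheet
# (SGA 1 V §1; Serre–Tate 1968 §1 Lemma 2; the «SHEET-COVER» organ of the ED.-3 census of `stub_MH`)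

Topic `Literature/AlgebraicGeometry/Motives`, namespace `Literature.AlgebraicGeometry.Motives.IntegralModel`.  THEOREMS only (no def, no instance, no
notation, no named fact, no `sorry`).  Sequel of ★ `Motives/GaloisThickening` (`R_L X = X ×_K Spec L` over `K`, the sections `ℓ_e = thickeningLift e`,
`(R_L X)(Ω) ≃ X(Ω) × Hom_K(L, Ω)`, the deck action `thickeningGalAction` permuting the sheets), ★ `Motives/GaloisThickeningQuotient` (for `L ∕ K`
normal any two sheets differ by a deck transformation), ★ `Motives/IntegralModelReductionMapSurjective` (the reduction map of a proper flat model is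
SURJECTIVE onto the `κ̄(v)`-points of the special fibre) and ★ `Motives/IntegralModelReductionMap` (`geomReductionMap_map`: reduction commutes with
model morphisms).  Cell `hodgecm-mathlib`, P6 «MOD programme», desk F0P6a-plan (g0) ED3-CENSUS-P6a v1 (2313221a) §6 organ **«SHEET-COVER»** (dealt to
A-p01 (g23)): «needed to transport HEART-FROB′ off the sheet-`e` image».  HC_CM is proved only modulo the printed citations until rung 0 closes;
nothing here is about HC.

THE MATHEMATICS.  `K` a number field, `v` a finite place, `Ω = \overline{K_v}`, `κ̄ = κ̄(v)`; `L ∕ K` normal, `X` a `K`-scheme, `𝓨` a PROPER FLAT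
model over `𝒪_{K,(v)}` of the thickening `R_L X`, with an action `θ` of `Aut(L∕K) × G` on `𝓨` over `Spec 𝒪_{K,(v)}` whose `Aut(L∕K)`-part has generic
fibre the deck action (the binder `_hθ` of the letter MH of `Lines/F0_P6a_ModuliDatum.lean`, literally), and `e : L → Ω` a sheet.  Then EVERY
`κ̄`-point `x̄` of the special fibre `𝓨_v` is `θ(γ, 1)_s · red_𝓨 (ℓ_e P)` for some deck transformation `γ` and some `P ∈ X(Ω)`:  `x̄ = red_𝓨 Q`
for some `Q ∈ (R_L X)(Ω)` (surjectivity of reduction for proper flat models, [SerreTate1968] §1 Lemma 2 ∕ [Liu2002] 10.1.38); `Q = ℓ_{e′} P` with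
`P = π_X Q` and `e′` the sheet of `Q`; `e′ = e ∘ γ′` for a deck transformation (`L ∕ K` normal), so `Q = γ · ℓ_e P` with `γ = γ′⁻¹` ([GortzWedhorn2020]
(14.20): the deck group moves the sheets); and reduction intertwines the generic deck transformation `γ` with `θ(γ, 1)_s` (`geomReductionMap_map`
through `_hθ`).  Consequently a property of special points which is stable under every `θ(γ, 1)_s` and holds on the reductions of the sheet-`e` sections
holds EVERYWHERE — the transport the heart uses for its Frobenius identity (HEART-FROB′ is proved on `red_𝓨 (ℓ_e (M⋆_{Kc}(Ω)))` and moved by `Γ`).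

MAIN STATEMENTS.  `geomReductionMap_map_thickeningGalAction_of_hθ` (reduction of a deck translate = `θ(γ,1)_s` of the reduction) ·
**`exists_aut_geomReductionMap_thickeningLift_eq`** (SHEET-COVER, proper + flat) · `exists_aut_geomReductionMap_thickeningLift_eq_of_isSmoothProper`
(the census wording: smooth proper model) · **`forall_specialPoint_of_forall_thickeningLift`** (transport of `θ(·,1)_s`-stable properties off the
sheet-`e` image) · `surjective_deckReduction` (the map `(γ, P) ↦ θ(γ,1)_s (red_𝓨 (ℓ_e P))` is onto).

## References
* [SGA1] A. Grothendieck, *SGA 1*, Exp. V §1 (schemes with a finite group of operators; the fibres of `X → X∕G` are orbits).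
* [SerreTate1968] J.-P. Serre, J. Tate, *Good reduction of abelian varieties*, Ann. of Math. 88 (1968), §1 Lemma 2 (reduction map of a proper model).
* [Liu2002] Q. Liu, *Algebraic Geometry and Arithmetic Curves* (2002), Cor. 10.1.38 (surjectivity of reduction for proper flat models).
* [GortzWedhorn2020] U. Görtz, T. Wedhorn, *Algebraic Geometry I* (2nd ed., 2020), (14.20), §(4.8)–(4.9) (points of `X ×_K Spec L`, Galois action).
* [StacksProject] The Stacks Project, Tag 0BME (embeddings of a normal extension differ by an automorphism).
-/

set_option autoImplicit false

noncomputable section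

open CategoryTheory _root_.AlgebraicGeometry Limits IsDedekindDomain IsDedekindDomain.HeightOneSpectrum Field
open scoped NumberField
open Literature.NumberTheory.EllipticCurves (genericFibre)
open Literature.NumberTheory.DiophantineGeometry
open Literature.AlgebraicGeometry.RelativeSpec (ActionOver)

universe u

namespace Literature.AlgebraicGeometry.Motives

namespace IntegralModel

variable {K : Type} [Field K] [NumberField K] {v : HeightOneSpectrum (𝓞 K)} {L : Type} [Field L] [Algebra K L]

/-! ## §1 Reduction intertwines the generic deck transformation `γ` with `θ(γ, 1)_s` -/

/-- **`red_𝓨 (γ · Q) = θ(γ, 1)_s · red_𝓨 Q`** for every `Ω`-point `Q` of `R_L X`, when the `Aut(L∕K)`-part of `θ` has generic fibre the deck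
action (the binder `_hθ` of the letter MH, literally) — ★ `geomReductionMap_map` for the model automorphism `θ(γ, 1)` covering the deck
transformation `γ` (★ `isoMk_thickeningGalAction_aut_hom` converts the `Over.isoMk` shape of `_hθ` to the `Over.homMk` shape of ★
`map_aut_thickeningLift`). [cite: SerreTate1968, §1 Lemma 2] [cite: GortzWedhorn2020, (14.20)] -/
theorem geomReductionMap_map_thickeningGalAction_of_hθ (X : SchemeOver K) {G : Type*} [Group G]
    (𝓨 : IntegralModel (valuationSubringAtPrime K v) K ((thickening K L).obj X)) [IsProper 𝓨.total.hom]
    (θ : ActionOver 𝓨.total.hom ((L ≃ₐ[K] L) × G))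
    (hθ : ∀ γ : L ≃ₐ[K] L,
      (genericFibre (valuationSubringAtPrime K v) K).map (Over.isoMk (θ.aut (γ, 1)) (θ.aut_comp (γ, 1))).hom ≫ 𝓨.genericIso'.hom =
        𝓨.genericIso'.hom ≫
          (Over.isoMk ((thickeningGalAction (L := L) X).aut γ) ((thickeningGalAction (L := L) X).aut_comp γ)).hom)
    (γ : L ≃ₐ[K] L) (Q : AlgPoints ((thickening K L).obj X) (AlgebraicClosure (v.adicCompletion K))) :
    𝓨.geomReductionMap
        (AlgPoints.map (Over.homMk ((thickeningGalAction X).aut γ).hom ((thickeningGalAction X).aut_comp γ)) Q) =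
      AlgPoints.map
          ((specialFibreFunctor v).map (Over.isoMk (θ.aut (γ, 1)) (θ.aut_comp (γ, 1))).hom : 𝓨.reductionAt ⟶ 𝓨.reductionAt)
        (𝓨.geomReductionMap Q) := by
  have h𝔲 : (genericFibre (valuationSubringAtPrime K v) K).map (Over.isoMk (θ.aut (γ, 1)) (θ.aut_comp (γ, 1))).hom ≫
      𝓨.genericIso'.hom =
        𝓨.genericIso'.hom ≫ Over.homMk ((thickeningGalAction X).aut γ).hom ((thickeningGalAction X).aut_comp γ) := by
    rw [hθ γ, isoMk_thickeningGalAction_aut_hom]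
  exact 𝓨.geomReductionMap_map 𝓨 _ _ h𝔲 Q

/-! ## §2 SHEET-COVER: every special point is a deck-translate of the reduction of a sheet-`e` section -/

/-- **SHEET-COVER** (desk F0P6a-plan ED3-CENSUS-P6a v1 §6).  `L ∕ K` normal, `𝓨` a PROPER FLAT `𝒪_{K,(v)}`-model of `R_L X` with an action `θ`
of `Aut(L∕K) × G` whose `Aut(L∕K)`-part extends the deck action (MH's `_hθ`), `e : L → \overline{K_v}` ANY sheet.  Then every `κ̄(v)`-point `x̄` of
the special fibre is `θ(γ, 1)_s (red_𝓨 (ℓ_e P))` for some deck transformation `γ` and some `P ∈ X(\overline{K_v})`.  Proof: `x̄ = red_𝓨 Q`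
(★ `geomReductionMap_surjective`, proper + flat), `Q = ℓ_{e′} (π_X Q)` (★ `thickeningLift_embOfPoint_map_thickeningπ`), `e′ = e ∘ γ′`
(★ `exists_algEquiv_comp_eq_of_normal`), `ℓ_{e ∘ γ′} P = γ′⁻¹ · ℓ_e P` (★ `map_aut_thickeningLift`), and §1.
[cite: SerreTate1968, §1 Lemma 2] [cite: Liu2002, Cor. 10.1.38] [cite: GortzWedhorn2020, (14.20)] [cite: StacksProject, Tag 0BME] -/
theorem exists_aut_geomReductionMap_thickeningLift_eq [Normal K L] (X : SchemeOver K) {G : Type*} [Group G]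
    (𝓨 : IntegralModel (valuationSubringAtPrime K v) K ((thickening K L).obj X)) [IsProper 𝓨.total.hom] [Flat 𝓨.total.hom]
    (θ : ActionOver 𝓨.total.hom ((L ≃ₐ[K] L) × G))
    (hθ : ∀ γ : L ≃ₐ[K] L,
      (genericFibre (valuationSubringAtPrime K v) K).map (Over.isoMk (θ.aut (γ, 1)) (θ.aut_comp (γ, 1))).hom ≫ 𝓨.genericIso'.hom =
        𝓨.genericIso'.hom ≫
          (Over.isoMk ((thickeningGalAction (L := L) X).aut γ) ((thickeningGalAction (L := L) X).aut_comp γ)).hom)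
    (e : L →ₐ[K] AlgebraicClosure (v.adicCompletion K)) (x : AlgPoints 𝓨.reductionAt (geomResidueField v)) :
    ∃ (γ : L ≃ₐ[K] L) (P : AlgPoints X (AlgebraicClosure (v.adicCompletion K))),
      x = AlgPoints.map
          ((specialFibreFunctor v).map (Over.isoMk (θ.aut (γ, 1)) (θ.aut_comp (γ, 1))).hom : 𝓨.reductionAt ⟶ 𝓨.reductionAt)
        (𝓨.geomReductionMap (thickeningLift e X P)) := by
  -- every special point is a reduction
  obtain ⟨Q, hQ⟩ := 𝓨.geomReductionMap_surjective x
  -- `Q = ℓ_{e′} P` with `P = π_X Q`, `e′` the sheet of `Q`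
  have hQ' : thickeningLift (AlgPoints.embOfPoint ((baseChange K L).obj X) Q) X (AlgPoints.map (thickeningπ X) Q) = Q :=
    thickeningLift_embOfPoint_map_thickeningπ X Q
  -- the two sheets differ by a deck transformation: `e ∘ γ′ = e′`
  obtain ⟨γ', hγ'⟩ := exists_algEquiv_comp_eq_of_normal e (AlgPoints.embOfPoint ((baseChange K L).obj X) Q)
  refine ⟨γ'.symm, AlgPoints.map (thickeningπ X) Q, ?_⟩
  -- `γ′⁻¹ · ℓ_e P = ℓ_{e ∘ γ′} P = Q`
  have h1 : AlgPoints.map (Over.homMk ((thickeningGalAction X).aut γ'.symm).hom ((thickeningGalAction X).aut_comp γ'.symm))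
      (thickeningLift e X (AlgPoints.map (thickeningπ X) Q)) = Q := by
    rw [map_aut_thickeningLift, AlgEquiv.symm_symm, hγ', hQ']
  rw [← hQ]
  conv_lhs => rw [← h1]
  exact 𝓨.geomReductionMap_map_thickeningGalAction_of_hθ X θ hθ γ'.symm _

/-- **SHEET-COVER for a smooth proper model** (the census wording; smooth ⇒ flat). [cite: SerreTate1968, §1 Lemma 2]
[cite: Liu2002, Cor. 10.1.38 and Prop. 10.1.40] [cite: GortzWedhorn2020, (14.20)] -/
theorem exists_aut_geomReductionMap_thickeningLift_eq_of_isSmoothProper [Normal K L] (X : SchemeOver K) {G : Type*} [Group G]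
    (𝓨 : IntegralModel (valuationSubringAtPrime K v) K ((thickening K L).obj X)) {d : ℕ} (h𝓨 : 𝓨.IsSmoothProper d)
    (θ : ActionOver 𝓨.total.hom ((L ≃ₐ[K] L) × G))
    (hθ : haveI := h𝓨.2
      ∀ γ : L ≃ₐ[K] L,
      (genericFibre (valuationSubringAtPrime K v) K).map (Over.isoMk (θ.aut (γ, 1)) (θ.aut_comp (γ, 1))).hom ≫ 𝓨.genericIso'.hom =
        𝓨.genericIso'.hom ≫
          (Over.isoMk ((thickeningGalAction (L := L) X).aut γ) ((thickeningGalAction (L := L) X).aut_comp γ)).hom)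
    (e : L →ₐ[K] AlgebraicClosure (v.adicCompletion K)) :
    haveI := h𝓨.2
    ∀ x : AlgPoints 𝓨.reductionAt (geomResidueField v),
      ∃ (γ : L ≃ₐ[K] L) (P : AlgPoints X (AlgebraicClosure (v.adicCompletion K))),
        x = AlgPoints.map
            ((specialFibreFunctor v).map (Over.isoMk (θ.aut (γ, 1)) (θ.aut_comp (γ, 1))).hom : 𝓨.reductionAt ⟶ 𝓨.reductionAt)
          (𝓨.geomReductionMap (thickeningLift e X P)) := by
  haveI := h𝓨.1
  haveI := h𝓨.2
  haveI : Smooth 𝓨.total.hom := SmoothOfRelativeDimension.smooth d _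
  exact fun x => 𝓨.exists_aut_geomReductionMap_thickeningLift_eq X θ hθ e x

/-! ## §3 Transport of `θ(·, 1)_s`-stable properties off the sheet-`e` image -/

/-- **Transport off the sheet-`e` image.**  A property `C` of the `κ̄(v)`-points of the special fibre which is STABLE under every `θ(γ, 1)_s` and
holds at the reductions `red_𝓨 (ℓ_e P)` of the sheet-`e` sections holds at EVERY special point (SHEET-COVER).  This is how the heart moves its
Frobenius identity, proved on `red_𝓨 (ℓ_e (X(\overline{K_v})))`, to all of `𝓨_v(κ̄)`. [cite: SerreTate1968, §1 Lemma 2] [cite: SGA1, Exp. V §1]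
[cite: GortzWedhorn2020, (14.20)] -/
theorem forall_specialPoint_of_forall_thickeningLift [Normal K L] (X : SchemeOver K) {G : Type*} [Group G]
    (𝓨 : IntegralModel (valuationSubringAtPrime K v) K ((thickening K L).obj X)) [IsProper 𝓨.total.hom] [Flat 𝓨.total.hom]
    (θ : ActionOver 𝓨.total.hom ((L ≃ₐ[K] L) × G))
    (hθ : ∀ γ : L ≃ₐ[K] L,
      (genericFibre (valuationSubringAtPrime K v) K).map (Over.isoMk (θ.aut (γ, 1)) (θ.aut_comp (γ, 1))).hom ≫ 𝓨.genericIso'.hom =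
        𝓨.genericIso'.hom ≫
          (Over.isoMk ((thickeningGalAction (L := L) X).aut γ) ((thickeningGalAction (L := L) X).aut_comp γ)).hom)
    (e : L →ₐ[K] AlgebraicClosure (v.adicCompletion K)) (C : AlgPoints 𝓨.reductionAt (geomResidueField v) → Prop)
    (hC : ∀ (γ : L ≃ₐ[K] L) (p : AlgPoints 𝓨.reductionAt (geomResidueField v)), C p →
      C (AlgPoints.map
          ((specialFibreFunctor v).map (Over.isoMk (θ.aut (γ, 1)) (θ.aut_comp (γ, 1))).hom : 𝓨.reductionAt ⟶ 𝓨.reductionAt) p))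
    (he : ∀ P : AlgPoints X (AlgebraicClosure (v.adicCompletion K)), C (𝓨.geomReductionMap (thickeningLift e X P)))
    (x : AlgPoints 𝓨.reductionAt (geomResidueField v)) : C x := by
  obtain ⟨γ, P, rfl⟩ := 𝓨.exists_aut_geomReductionMap_thickeningLift_eq X θ hθ e x
  exact hC γ _ (he P)

/-- **The deck-reduction map is onto**: `(γ, P) ↦ θ(γ, 1)_s (red_𝓨 (ℓ_e P))`, `Aut(L∕K) × X(\overline{K_v}) → 𝓨_v(κ̄)`, is surjective
(SHEET-COVER as a surjectivity statement). [cite: SerreTate1968, §1 Lemma 2] [cite: GortzWedhorn2020, (14.20)] -/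
theorem surjective_deckReduction [Normal K L] (X : SchemeOver K) {G : Type*} [Group G]
    (𝓨 : IntegralModel (valuationSubringAtPrime K v) K ((thickening K L).obj X)) [IsProper 𝓨.total.hom] [Flat 𝓨.total.hom]
    (θ : ActionOver 𝓨.total.hom ((L ≃ₐ[K] L) × G))
    (hθ : ∀ γ : L ≃ₐ[K] L,
      (genericFibre (valuationSubringAtPrime K v) K).map (Over.isoMk (θ.aut (γ, 1)) (θ.aut_comp (γ, 1))).hom ≫ 𝓨.genericIso'.hom =
        𝓨.genericIso'.hom ≫
          (Over.isoMk ((thickeningGalAction (L := L) X).aut γ) ((thickeningGalAction (L := L) X).aut_comp γ)).hom)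
    (e : L →ₐ[K] AlgebraicClosure (v.adicCompletion K)) :
    Function.Surjective fun q : (L ≃ₐ[K] L) × AlgPoints X (AlgebraicClosure (v.adicCompletion K)) =>
      AlgPoints.map
          ((specialFibreFunctor v).map (Over.isoMk (θ.aut (q.1, 1)) (θ.aut_comp (q.1, 1))).hom : 𝓨.reductionAt ⟶ 𝓨.reductionAt)
        (𝓨.geomReductionMap (thickeningLift e X q.2)) := by
  intro x
  obtain ⟨γ, P, h⟩ := 𝓨.exists_aut_geomReductionMap_thickeningLift_eq X θ hθ e x
  exact ⟨(γ, P), h.symm⟩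

end IntegralModel

end Literature.AlgebraicGeometry.Motives

end
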